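import Summits.CriticalPhenomena.PercolationContinuityZ3.Theorems.PercNearOneGluingNoHeavyLowerTailKnQuestion8CoefficientwiseCoreClassKernelMixTwoArms

/-!
# Two-arm gluing for the chordless two-type inequality, IV: the theorem on the product `P × Q`

Support file (`--supports stmt-CriticalPhenomena-4575`, closed), prover `prim-cplus-coupling` (gen 71).  No definitions, no named
facts, no sorries; standard axioms.  Memo `prim-cplus-coupling/A5-COUPLING-gen71.md` §2; block form in `…KernelMixTwoArms`.

For two blocks `P, Q` (least/greatest elements `b, t`, mirror involutions `c` with `c b = t`, levels `D, B` lower and avoiding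
`t`, each block satisfying the single-block chorded two-type inequality (X2₁) for all pairs of upper families) the CHORDLESS
two-block bouquet lives on `P × Q` (product order, mirror `(c_P, c_Q)`): demand region `G = {b_P} × (Q∖t_Q) ∪ (P∖t_P) × {b_Q}`,
levels `D = {b_P} × D_Q ∪ D_P × {b_Q}` (consistent at the corner), typed targets `{z | c z ∈ D}`, supply region `{z | c z ∈ G}`,
pool `G ∖ (D ∪ B)`.
* `TwoArms.card_cross` — a family supported on the cross `{a} × Q ∪ P × {b}` is counted by its `Q`-column plus its `P`-row minus the
  centre.
* `TwoArms.two_arms_product` — **THEOREM (chordless two-type inequality for two-block bouquets)**: for all upper families `A, C`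
  of `P × Q`,  `#((A∖C)∩(D∖B)) + #((C∖A)∩(B∖D)) ≤ #((A∖C)∩c⁻¹D) + #((C∖A)∩c⁻¹B) + #(A∩C∩c⁻¹G) + #(A∩C∩(G∖(D∪B)))`.
  Proof: read the fibres of `A, C` over `b_P, t_P` and their rows at `b_Q, t_Q`, check the couplings from the product order, apply
  `two_arms_blockForm`, and count both sides along the bottom cross (sources, pool) and the top cross (targets, supply).
[cite: KozmaNitzan2024, Questions 8–9 (§5.5 p. 36) (context); Harris 1960; Kleitman 1966]
-/

namespace Summit.CriticalPhenomena.PercolationContinuityZ3.Theorems.Coefficientwise.TwoArms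

open Finset

variable {P Q : Type*} [Fintype P] [DecidableEq P] [Fintype Q] [DecidableEq Q]

/-- A family supported on the cross `{a} × Q ∪ P × {b}` is counted by its column over `a` plus its row at `b` with the centre
`(a, b)` removed from the row. -/
theorem card_cross (a : P) (b : Q) (S : Finset (P × Q)) (hS : ∀ z ∈ S, z.1 = a ∨ z.2 = b) :
    S.card = (univ.filter (fun q => (a, q) ∈ S)).card + ((univ.filter (fun p => (p, b) ∈ S)).erase a).card := by
  have hdec : S = (univ.filter (fun q => (a, q) ∈ S)).image (fun q => (a, q)) ∪
      ((univ.filter (fun p => (p, b) ∈ S)).erase a).image (fun p => (p, b)) := by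
    ext ⟨p, q⟩
    simp only [mem_union, mem_image, mem_filter, mem_univ, true_and, mem_erase, Prod.mk.injEq]
    constructor
    · intro h
      rcases hS (p, q) h with hp | hq
      · have hp : p = a := hp
        rw [hp] at h ⊢
        exact Or.inl ⟨q, h, rfl, rfl⟩
      · have hq : q = b := hq
        rw [hq] at h ⊢
        by_cases hp : p = a
        · rw [hp] at h ⊢
          exact Or.inl ⟨b, h, rfl, rfl⟩
        · exact Or.inr ⟨p, ⟨hp, h⟩, rfl, rfl⟩
    · rintro (⟨q', hq', rfl, rfl⟩ | ⟨p', ⟨_, hp'⟩, rfl, rfl⟩)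
      · exact hq'
      · exact hp'
  have hdisj : Disjoint ((univ.filter (fun q => (a, q) ∈ S)).image (fun q => (a, q)))
      (((univ.filter (fun p => (p, b) ∈ S)).erase a).image (fun p => (p, b))) := by
    rw [disjoint_left]
    intro z hz hz'
    obtain ⟨q, _, rfl⟩ := mem_image.mp hz
    obtain ⟨p, hp, hpq⟩ := mem_image.mp hz'
    have : p = a := (Prod.mk.injEq _ _ _ _ ▸ hpq |>.1)
    exact (mem_erase.mp hp).1 this
  have hinjQ : Function.Injective (fun q : Q => (a, q)) := fun q q' h => (Prod.mk.injEq _ _ _ _ ▸ h).2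
  have hinjP : Function.Injective (fun p : P => (p, b)) := fun p p' h => (Prod.mk.injEq _ _ _ _ ▸ h).1
  conv_lhs => rw [hdec]
  rw [card_union_of_disjoint hdisj, card_image_of_injective _ hinjQ, card_image_of_injective _ hinjP]

omit [Fintype P] [Fintype Q] in
/-- Membership in a family supported on the bottom cross, built from a column family `S ⊆ Q` over `a` and a row family
`T ⊆ P` at `b`. -/
theorem mem_cross_iff (a : P) (b : Q) (S : Finset Q) (T : Finset P) (p : P) (q : Q) :
    (p, q) ∈ S.image (fun q => (a, q)) ∪ T.image (fun p => (p, b)) ↔ (p = a ∧ q ∈ S) ∨ (q = b ∧ p ∈ T) := by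
  simp only [mem_union, mem_image, Prod.mk.injEq]
  constructor
  · rintro (⟨q', hq', hp, hq⟩ | ⟨p', hp', hp, hq⟩)
    · exact Or.inl ⟨hp.symm, hq ▸ hq'⟩
    · exact Or.inr ⟨hq.symm, hp ▸ hp'⟩
  · rintro (⟨rfl, hq⟩ | ⟨rfl, hp⟩)
    · exact Or.inl ⟨q, hq, rfl, rfl⟩
    · exact Or.inr ⟨p, hp, rfl, rfl⟩

section Product

variable {P Q : Type*} [Fintype P] [DecidableEq P] [Preorder P] [Fintype Q] [DecidableEq Q] [Preorder Q]

/-- **THEOREM (chordless two-type inequality for two-block bouquets, product form).**  On `P × Q` with the product order and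
the mirror `(c_P, c_Q)`, for the chordless demand region `G = {b_P} × (Q∖t_Q) ∪ (P∖t_P) × {b_Q}`, levels
`D = {b_P} × D_Q ∪ D_P × {b_Q}`, `B` likewise (single-block levels satisfying the chorded inequality (X2₁), consistent at the
corner), and ALL upper families `A, C` of `P × Q`:
`#((A∖C)∩(D∖B)) + #((C∖A)∩(B∖D)) ≤ #((A∖C)∩c⁻¹D) + #((C∖A)∩c⁻¹B) + #(A∩C∩c⁻¹G) + #(A∩C∩(G∖(D∪B)))`.
Memo gen 71 §2: fibres and rows of `A, C`, couplings from the product order, `two_arms_blockForm`, counting along the two crosses. -/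
theorem two_arms_product
    (bP tP : P) (cP : P → P) (DP BP : Finset P)
    (hbP : ∀ p, bP ≤ p) (htP : ∀ p, p ≤ tP) (hbtP : bP ≠ tP) (hcP : Function.Involutive cP) (hcPb : cP bP = tP)
    (hDPl : IsLowerSet (DP : Set P)) (hBPl : IsLowerSet (BP : Set P)) (hDPt : tP ∉ DP) (hBPt : tP ∉ BP)
    (hXP : ∀ A C : Finset P, IsUpperSet (A : Set P) → IsUpperSet (C : Set P) →
      ((A \ C) ∩ (DP \ BP)).card + ((C \ A) ∩ (BP \ DP)).card ≤
        ((A \ C) ∩ univ.filter (fun x => cP x ∈ DP)).card + ((C \ A) ∩ univ.filter (fun x => cP x ∈ BP)).card +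
          (A ∩ C ∩ univ.erase bP).card + (A ∩ C ∩ (univ.erase tP \ (DP ∪ BP))).card)
    (bQ tQ : Q) (cQ : Q → Q) (DQ BQ : Finset Q)
    (hbQ : ∀ q, bQ ≤ q) (htQ : ∀ q, q ≤ tQ) (hbtQ : bQ ≠ tQ) (hcQ : Function.Involutive cQ) (hcQb : cQ bQ = tQ)
    (hDQt : tQ ∉ DQ) (hBQt : tQ ∉ BQ)
    (hXQ : ∀ A C : Finset Q, IsUpperSet (A : Set Q) → IsUpperSet (C : Set Q) →
      ((A \ C) ∩ (DQ \ BQ)).card + ((C \ A) ∩ (BQ \ DQ)).card ≤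
        ((A \ C) ∩ univ.filter (fun x => cQ x ∈ DQ)).card + ((C \ A) ∩ univ.filter (fun x => cQ x ∈ BQ)).card +
          (A ∩ C ∩ univ.erase bQ).card + (A ∩ C ∩ (univ.erase tQ \ (DQ ∪ BQ))).card)
    (hDc : bP ∈ DP ↔ bQ ∈ DQ) (hBc : bP ∈ BP ↔ bQ ∈ BQ)
    (Dz Bz Gz : Finset (P × Q))
    (hDz : Dz = DQ.image (fun q => (bP, q)) ∪ DP.image (fun p => (p, bQ)))
    (hBz : Bz = BQ.image (fun q => (bP, q)) ∪ BP.image (fun p => (p, bQ)))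
    (hGz : Gz = (univ.erase tQ).image (fun q => (bP, q)) ∪ (univ.erase tP).image (fun p => (p, bQ)))
    (A C : Finset (P × Q)) (hA : IsUpperSet (A : Set (P × Q))) (hC : IsUpperSet (C : Set (P × Q))) :
    ((A \ C) ∩ (Dz \ Bz)).card + ((C \ A) ∩ (Bz \ Dz)).card ≤
      ((A \ C) ∩ univ.filter (fun z : P × Q => (cP z.1, cQ z.2) ∈ Dz)).card +
          ((C \ A) ∩ univ.filter (fun z : P × Q => (cP z.1, cQ z.2) ∈ Bz)).card +
        (A ∩ C ∩ univ.filter (fun z : P × Q => (cP z.1, cQ z.2) ∈ Gz)).card + (A ∩ C ∩ (Gz \ (Dz ∪ Bz))).card := by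
  have hcPt : cP tP = bP := by rw [← hcPb, hcP bP]
  have hcQt : cQ tQ = bQ := by rw [← hcQb, hcQ bQ]
  have hcPeq : ∀ p, cP p = bP ↔ p = tP := fun p =>
    ⟨fun h => by rw [← hcP p, h, hcPb], fun h => by rw [h, hcPt]⟩
  have hcQeq : ∀ q, cQ q = bQ ↔ q = tQ := fun q =>
    ⟨fun h => by rw [← hcQ q, h, hcQb], fun h => by rw [h, hcQt]⟩
  have hcPeq' : ∀ p, cP p = tP ↔ p = bP := fun p =>
    ⟨fun h => by rw [← hcP p, h, hcPt], fun h => by rw [h, hcPb]⟩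
  have hcQeq' : ∀ q, cQ q = tQ ↔ q = bQ := fun q =>
    ⟨fun h => by rw [← hcQ q, h, hcQt], fun h => by rw [h, hcQb]⟩
  -- columns and rows of the three regions
  have hDcol : ∀ q, (bP, q) ∈ Dz ↔ q ∈ DQ := by
    intro q; rw [hDz, mem_cross_iff]
    constructor
    · rintro (⟨_, h⟩ | ⟨rfl, h⟩)
      · exact h
      · exact hDc.mp h
    · exact fun h => Or.inl ⟨rfl, h⟩
  have hDrow : ∀ p, (p, bQ) ∈ Dz ↔ p ∈ DP := by
    intro p; rw [hDz, mem_cross_iff]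
    constructor
    · rintro (⟨rfl, h⟩ | ⟨_, h⟩)
      · exact hDc.mpr h
      · exact h
    · exact fun h => Or.inr ⟨rfl, h⟩
  have hBcol : ∀ q, (bP, q) ∈ Bz ↔ q ∈ BQ := by
    intro q; rw [hBz, mem_cross_iff]
    constructor
    · rintro (⟨_, h⟩ | ⟨rfl, h⟩)
      · exact h
      · exact hBc.mp h
    · exact fun h => Or.inl ⟨rfl, h⟩
  have hBrow : ∀ p, (p, bQ) ∈ Bz ↔ p ∈ BP := by
    intro p; rw [hBz, mem_cross_iff]
    constructor
    · rintro (⟨rfl, h⟩ | ⟨_, h⟩)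
      · exact hBc.mpr h
      · exact h
    · exact fun h => Or.inr ⟨rfl, h⟩
  have hGcol : ∀ q, (bP, q) ∈ Gz ↔ q ≠ tQ := by
    intro q; rw [hGz, mem_cross_iff]
    constructor
    · rintro (⟨_, h⟩ | ⟨rfl, _⟩)
      · exact (mem_erase.mp h).1
      · exact hbtQ
    · exact fun h => Or.inl ⟨rfl, mem_erase.mpr ⟨h, mem_univ _⟩⟩
  have hGrow : ∀ p, (p, bQ) ∈ Gz ↔ p ≠ tP := by
    intro p; rw [hGz, mem_cross_iff]
    constructor
    · rintro (⟨rfl, _⟩ | ⟨_, h⟩)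
      · exact hbtP
      · exact (mem_erase.mp h).1
    · exact fun h => Or.inr ⟨rfl, mem_erase.mpr ⟨h, mem_univ _⟩⟩
  -- supports: the regions lie on the bottom cross, their mirror preimages on the top cross
  have hsupp : ∀ (S : Finset Q) (T : Finset P) (z : P × Q),
      z ∈ S.image (fun q => (bP, q)) ∪ T.image (fun p => (p, bQ)) → z.1 = bP ∨ z.2 = bQ := by
    rintro S T ⟨p, q⟩ hz
    rcases (mem_cross_iff bP bQ S T p q).mp hz with ⟨h, _⟩ | ⟨h, _⟩
    · exact Or.inl h
    · exact Or.inr h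
  have hsupp' : ∀ (S : Finset Q) (T : Finset P) (z : P × Q),
      (cP z.1, cQ z.2) ∈ S.image (fun q => (bP, q)) ∪ T.image (fun p => (p, bQ)) → z.1 = tP ∨ z.2 = tQ := by
    rintro S T ⟨p, q⟩ hz
    rcases (mem_cross_iff bP bQ S T (cP p) (cQ q)).mp hz with ⟨h, _⟩ | ⟨h, _⟩
    · exact Or.inl ((hcPeq p).mp h)
    · exact Or.inr ((hcQeq q).mp h)
  -- fibres and rows of `A`, `C`
  set AQb : Finset Q := univ.filter (fun q => (bP, q) ∈ A) with eAQb
  set AQt : Finset Q := univ.filter (fun q => (tP, q) ∈ A) with eAQt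
  set CQb : Finset Q := univ.filter (fun q => (bP, q) ∈ C) with eCQb
  set CQt : Finset Q := univ.filter (fun q => (tP, q) ∈ C) with eCQt
  set APb : Finset P := univ.filter (fun p => (p, bQ) ∈ A) with eAPb
  set APt : Finset P := univ.filter (fun p => (p, tQ) ∈ A) with eAPt
  set CPb : Finset P := univ.filter (fun p => (p, bQ) ∈ C) with eCPb
  set CPt : Finset P := univ.filter (fun p => (p, tQ) ∈ C) with eCPt
  -- upper families and couplings from the product order
  have upcol : ∀ (U : Finset (P × Q)), IsUpperSet (U : Set (P × Q)) → ∀ p : P,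
      IsUpperSet ((univ.filter (fun q => (p, q) ∈ U) : Finset Q) : Set Q) := by
    intro U hU p q q' hqq' hq
    rw [mem_coe, mem_filter] at hq ⊢
    exact ⟨mem_univ _, mem_coe.mp (hU (Prod.mk_le_mk.mpr ⟨le_rfl, hqq'⟩) (mem_coe.mpr hq.2))⟩
  have uprow : ∀ (U : Finset (P × Q)), IsUpperSet (U : Set (P × Q)) → ∀ q : Q,
      IsUpperSet ((univ.filter (fun p => (p, q) ∈ U) : Finset P) : Set P) := by
    intro U hU q p p' hpp' hp
    rw [mem_coe, mem_filter] at hp ⊢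
    exact ⟨mem_univ _, mem_coe.mp (hU (Prod.mk_le_mk.mpr ⟨hpp', le_rfl⟩) (mem_coe.mpr hp.2))⟩
  have mono : ∀ (U : Finset (P × Q)), IsUpperSet (U : Set (P × Q)) → ∀ z z' : P × Q, z ≤ z' → z ∈ U → z' ∈ U :=
    fun U hU z z' hzz' hz => mem_coe.mp (hU hzz' (mem_coe.mpr hz))
  have colsub : ∀ (U : Finset (P × Q)), IsUpperSet (U : Set (P × Q)) →
      univ.filter (fun q => (bP, q) ∈ U) ⊆ univ.filter (fun q => (tP, q) ∈ U) := by
    intro U hU q hq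
    exact mem_filter.mpr ⟨mem_univ _, mono U hU _ _ (Prod.mk_le_mk.mpr ⟨hbP tP, le_rfl⟩) (mem_filter.mp hq).2⟩
  have rowsub : ∀ (U : Finset (P × Q)), IsUpperSet (U : Set (P × Q)) →
      univ.filter (fun p => (p, bQ) ∈ U) ⊆ univ.filter (fun p => (p, tQ) ∈ U) := by
    intro U hU p hp
    exact mem_filter.mpr ⟨mem_univ _, mono U hU _ _ (Prod.mk_le_mk.mpr ⟨le_rfl, hbQ tQ⟩) (mem_filter.mp hp).2⟩
  have corner : ∀ (U : Finset (P × Q)), bQ ∈ univ.filter (fun q => (bP, q) ∈ U) ↔ bP ∈ univ.filter (fun p => (p, bQ) ∈ U) := by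
    intro U; simp only [mem_filter, mem_univ, true_and]
  have apex : ∀ (U : Finset (P × Q)), tQ ∈ univ.filter (fun q => (tP, q) ∈ U) ↔ tP ∈ univ.filter (fun p => (p, tQ) ∈ U) := by
    intro U; simp only [mem_filter, mem_univ, true_and]
  have rowcol : ∀ (U : Finset (P × Q)), IsUpperSet (U : Set (P × Q)) →
      (univ.filter (fun p => (p, bQ) ∈ U)).Nonempty → univ.filter (fun q => (tP, q) ∈ U) = univ := by
    intro U hU ⟨p, hp⟩
    ext q
    simp only [mem_filter, mem_univ, true_and, iff_true]
    exact mono U hU _ _ (Prod.mk_le_mk.mpr ⟨htP p, hbQ q⟩) (mem_filter.mp hp).2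
  have colrow : ∀ (U : Finset (P × Q)), IsUpperSet (U : Set (P × Q)) →
      (univ.filter (fun q => (bP, q) ∈ U)).Nonempty → univ.filter (fun p => (p, tQ) ∈ U) = univ := by
    intro U hU ⟨q, hq⟩
    ext p
    simp only [mem_filter, mem_univ, true_and, iff_true]
    exact mono U hU _ _ (Prod.mk_le_mk.mpr ⟨hbP p, htQ q⟩) (mem_filter.mp hq).2
  -- the block-form theorem
  have hblock := two_arms_blockForm bP tP cP DP BP hbP hcP hcPb hDPl hBPl hDPt hBPt hXP bQ tQ cQ DQ BQ htQ hbtQ hcQ hcQb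
    hDQt hBQt hXQ hDc hBc AQb AQt CQb CQt APb APt CPb CPt (upcol A hA bP) (upcol C hC bP) (uprow A hA bQ) (uprow C hC bQ)
    (colsub A hA) (colsub C hC) (rowsub A hA) (rowsub C hC) (corner A) (corner C) (apex A) (apex C)
    (rowcol A hA) (rowcol C hC) (colrow A hA) (colrow C hC)
  -- counting along the bottom cross: sources and pool
  have eL1 : ((A \ C) ∩ (Dz \ Bz)).card = ((AQb \ CQb) ∩ (DQ \ BQ)).card + (((APb \ CPb) ∩ (DP \ BP)).erase bP).card := by
    rw [card_cross bP bQ ((A \ C) ∩ (Dz \ Bz)) (fun z hz => by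
      rw [hDz] at hz; exact hsupp DQ DP z (mem_sdiff.mp (mem_inter.mp hz).2).1)]
    congr 2
    · ext q; simp only [eAQb, eCQb, mem_filter, mem_univ, true_and, mem_inter, mem_sdiff, hDcol q, hBcol q]
    · ext p; simp only [eAPb, eCPb, mem_filter, mem_univ, true_and, mem_inter, mem_sdiff, mem_erase, hDrow p, hBrow p]
  have eL2 : ((C \ A) ∩ (Bz \ Dz)).card = ((CQb \ AQb) ∩ (BQ \ DQ)).card + (((CPb \ APb) ∩ (BP \ DP)).erase bP).card := by
    rw [card_cross bP bQ ((C \ A) ∩ (Bz \ Dz)) (fun z hz => by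
      rw [hBz] at hz; exact hsupp BQ BP z (mem_sdiff.mp (mem_inter.mp hz).2).1)]
    congr 2
    · ext q; simp only [eAQb, eCQb, mem_filter, mem_univ, true_and, mem_inter, mem_sdiff, hDcol q, hBcol q]
    · ext p; simp only [eAPb, eCPb, mem_filter, mem_univ, true_and, mem_inter, mem_sdiff, mem_erase, hDrow p, hBrow p]
  have eR4 : (A ∩ C ∩ (Gz \ (Dz ∪ Bz))).card =
      (AQb ∩ CQb ∩ (univ.erase tQ \ (DQ ∪ BQ))).card + ((APb ∩ CPb ∩ (univ.erase tP \ (DP ∪ BP))).erase bP).card := by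
    rw [card_cross bP bQ (A ∩ C ∩ (Gz \ (Dz ∪ Bz))) (fun z hz => by
      rw [hGz] at hz; exact hsupp _ _ z (mem_sdiff.mp (mem_inter.mp hz).2).1)]
    congr 2
    · ext q
      simp only [eAQb, eCQb, mem_filter, mem_univ, true_and, mem_inter, mem_sdiff, mem_union, mem_erase, hDcol q, hBcol q,
        hGcol q, ne_eq, and_true]
    · ext p
      simp only [eAPb, eCPb, mem_filter, mem_univ, true_and, mem_inter, mem_sdiff, mem_union, mem_erase, hDrow p, hBrow p,
        hGrow p, ne_eq, and_true]
  -- counting along the top cross: typed targets and supply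
  have eR1 : ((A \ C) ∩ univ.filter (fun z : P × Q => (cP z.1, cQ z.2) ∈ Dz)).card =
      ((AQt \ CQt) ∩ univ.filter (fun x => cQ x ∈ DQ)).card +
        (((APt \ CPt) ∩ univ.filter (fun x => cP x ∈ DP)).erase tP).card := by
    rw [card_cross tP tQ ((A \ C) ∩ univ.filter (fun z : P × Q => (cP z.1, cQ z.2) ∈ Dz)) (fun z hz => by
      have hz' := (mem_filter.mp (mem_inter.mp hz).2).2
      rw [hDz] at hz'; exact hsupp' DQ DP z hz')]
    congr 2
    · ext q; simp only [eAQt, eCQt, mem_filter, mem_univ, true_and, mem_inter, mem_sdiff, hcPt, hDcol (cQ q)]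
    · ext p; simp only [eAPt, eCPt, mem_filter, mem_univ, true_and, mem_inter, mem_sdiff, mem_erase, hcQt, hDrow (cP p)]
  have eR2 : ((C \ A) ∩ univ.filter (fun z : P × Q => (cP z.1, cQ z.2) ∈ Bz)).card =
      ((CQt \ AQt) ∩ univ.filter (fun x => cQ x ∈ BQ)).card +
        (((CPt \ APt) ∩ univ.filter (fun x => cP x ∈ BP)).erase tP).card := by
    rw [card_cross tP tQ ((C \ A) ∩ univ.filter (fun z : P × Q => (cP z.1, cQ z.2) ∈ Bz)) (fun z hz => by
      have hz' := (mem_filter.mp (mem_inter.mp hz).2).2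
      rw [hBz] at hz'; exact hsupp' BQ BP z hz')]
    congr 2
    · ext q; simp only [eAQt, eCQt, mem_filter, mem_univ, true_and, mem_inter, mem_sdiff, hcPt, hBcol (cQ q)]
    · ext p; simp only [eAPt, eCPt, mem_filter, mem_univ, true_and, mem_inter, mem_sdiff, mem_erase, hcQt, hBrow (cP p)]
  have eR3 : (A ∩ C ∩ univ.filter (fun z : P × Q => (cP z.1, cQ z.2) ∈ Gz)).card =
      (AQt ∩ CQt ∩ univ.erase bQ).card + ((APt ∩ CPt ∩ univ.erase bP).erase tP).card := by
    rw [card_cross tP tQ (A ∩ C ∩ univ.filter (fun z : P × Q => (cP z.1, cQ z.2) ∈ Gz)) (fun z hz => by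
      have hz' := (mem_filter.mp (mem_inter.mp hz).2).2
      rw [hGz] at hz'; exact hsupp' _ _ z hz')]
    congr 2
    · ext q
      simp only [eAQt, eCQt, mem_filter, mem_univ, true_and, mem_inter, mem_erase, hcPt, hGcol (cQ q), ne_eq, hcQeq' q,
        and_true]
    · ext p
      simp only [eAPt, eCPt, mem_filter, mem_univ, true_and, mem_inter, mem_erase, hcQt, hGrow (cP p), ne_eq, hcPeq' p,
        and_true]
  rw [eL1, eL2, eR1, eR2, eR3, eR4]
  omega

end Product

end Summit.CriticalPhenomena.PercolationContinuityZ3.Theorems.Coefficientwise.TwoArms
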